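import Summits.AnomalousDissipation.AnomalousDissipation.Theorems.SolenoidalFractalHomogenisationRealisedQuasiStaticCellLawInPlaneWeightLower
import Summits.AnomalousDissipation.AnomalousDissipation.Theorems.SolenoidalFractalHomogenisationRealisedQuasiStaticCellLawCosetGeometry
import Literature.Analysis.FunctionSpaces.TorusHeatSmoothing
import HarnessLib

/-!
# K2R `RealisedQuasiStaticCellLaw`, line `floquet-bloch`, stub `stub_upperSome`: UPPER bounds of the two second-order
# slaving weights of a principal coset (out-of-plane `σ_o ≤ 2 + 2r`, in-plane `σ_i ≤ 2cos²∠(ℓ,K) + 26r`, `r = |ℓ|/|K| ≤ 1/8`)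

Summits-side helper (everything proved; no definitions, no named facts; `--supports stmt-AnomalousDissipation-20446`).
Companion of `outPlane_weight_ge_two` / `inPlane_weight_lower` (`…InPlaneWeightLower`, LOWER bounds used by S1D): the
`stub_upperSome` lane needs the weights bounded ABOVE by their nominal Taylor values. With `y = 2ℓ·K/|K|²` the gaps are
`d_{±1} − d₀ = 1 ± y`, the Leray cosines are `s₀ = cos∠(ℓ, ℓ+K)`, `s₋₁ = cos∠(ℓ−K, ℓ)` (`inPlane_link_eq_cos`); in the
variables `r = |ℓ|/|K|`, `c = cos∠(ℓ,K)`: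
`σ_o = 2/(1 − 4r²c²) ≤ 2 + 2r`, `σ_i = (c−r)²/((1−2rc+r²)(1−2rc)) + (c+r)²/((1+2rc+r²)(1+2rc)) ≤ 2c² + 26r` for `r ≤ 1/8`
(`slaving_weights_upper`). Energy LOWER-bound half of the K2R bracket; not anomalous dissipation.
-/

set_option linter.dupNamespace false -- layout D-0017: `AnomalousDissipation.AnomalousDissipation` repeats by design

noncomputable section

namespace Summit.AnomalousDissipation.AnomalousDissipation.Theorems.SolenoidalFractalHomogenisation.RealisedQuasiStaticCellLaw

open Matrix
open scoped Matrix InnerProductSpace RealInnerProductSpace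
open Literature.Analysis Literature.Analysis.FunctionSpaces Literature.Analysis.FunctionSpaces.Torus

/-- The elementary bound behind `σ_i ≤ 2c² + 26r`: for `0 < r ≤ 1/8`, `|c| ≤ 1`,
`(c + r)²/((r² + 2rc + 1)(1 + 2rc)) ≤ (c² + 2r + r²)(1 + 8r)`. -/
theorem inPlane_term_le (r c : ℝ) (hr0 : 0 < r) (hr : r ≤ 1 / 8) (hc : |c| ≤ 1) :
    (c + r) ^ 2 / ((r ^ 2 + 2 * r * c + 1) * (1 + 2 * r * c)) ≤ (c ^ 2 + 2 * r + r ^ 2) * (1 + 8 * r) := by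
  have hc1 : c ≤ 1 := (le_abs_self c).trans hc
  have hc2 : -1 ≤ c := by linarith [neg_abs_le c]
  have hrc : -r ≤ r * c := by nlinarith
  have hrc' : r * c ≤ r := by nlinarith
  have hD1 : 1 - 2 * r ≤ r ^ 2 + 2 * r * c + 1 := by nlinarith [sq_nonneg r]
  have hD2 : 1 - 2 * r ≤ 1 + 2 * r * c := by linarith
  have h12 : 0 < 1 - 2 * r := by linarith
  have hD1p : 0 < r ^ 2 + 2 * r * c + 1 := lt_of_lt_of_le h12 hD1
  have hD2p : 0 < 1 + 2 * r * c := lt_of_lt_of_le h12 hD2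
  have hnum : (c + r) ^ 2 ≤ c ^ 2 + 2 * r + r ^ 2 := by nlinarith
  have hnum0 : 0 ≤ c ^ 2 + 2 * r + r ^ 2 := by positivity
  -- `1/((1−2r)²) ≤ 1 + 8r` on `[0, 1/8]`
  have hinv : 1 ≤ (1 - 2 * r) ^ 2 * (1 + 8 * r) := by nlinarith
  calc (c + r) ^ 2 / ((r ^ 2 + 2 * r * c + 1) * (1 + 2 * r * c))
      ≤ (c ^ 2 + 2 * r + r ^ 2) / ((1 - 2 * r) * (1 - 2 * r)) :=
        div_le_div₀ hnum0 hnum (mul_pos h12 h12) (mul_le_mul hD1 hD2 h12.le hD1p.le)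
    _ ≤ (c ^ 2 + 2 * r + r ^ 2) * (1 + 8 * r) := by
        rw [div_le_iff₀ (mul_pos h12 h12)]
        have := mul_le_mul_of_nonneg_left hinv hnum0
        nlinarith

/-- Reduced out-of-plane bound: `1/(1−2rc) + 1/(1+2rc) ≤ 2 + 2r` for `0 < r ≤ 1/8`, `|c| ≤ 1`. -/
theorem outPlane_reduced_le (r c : ℝ) (hr0 : 0 < r) (hr : r ≤ 1 / 8) (hc : |c| ≤ 1) :
    1 / (1 - 2 * r * c) + 1 / (1 + 2 * r * c) ≤ 2 + 2 * r := by
  have hc1 : c ≤ 1 := (le_abs_self c).trans hc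
  have hc2 : -1 ≤ c := by linarith [neg_abs_le c]
  have hlo : -r ≤ r * c := by nlinarith
  have hhi : r * c ≤ r := by nlinarith
  have hp : 0 < 1 + 2 * r * c := by linarith
  have hm : 0 < 1 - 2 * r * c := by linarith
  have hcsq : c ^ 2 ≤ 1 := by nlinarith
  have hrc : r ^ 2 * c ^ 2 ≤ r ^ 2 := by nlinarith [sq_nonneg r]
  rw [div_add_div _ _ hm.ne' hp.ne', div_le_iff₀ (mul_pos hm hp)]
  nlinarith [mul_pos hr0 hr0, sq_nonneg c]

/-- Reduced in-plane bound: the two terms of `σ_i` sum to at most `2c² + 26r` for `0 < r ≤ 1/8`, `|c| ≤ 1`. -/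
theorem inPlane_reduced_le (r c : ℝ) (hr0 : 0 < r) (hr : r ≤ 1 / 8) (hc : |c| ≤ 1) :
    (-c + r) ^ 2 / ((r ^ 2 + 2 * r * (-c) + 1) * (1 + 2 * r * (-c))) +
        (c + r) ^ 2 / ((r ^ 2 + 2 * r * c + 1) * (1 + 2 * r * c)) ≤ 2 * c ^ 2 + 26 * r := by
  have t1 := inPlane_term_le r c hr0 hr hc
  have t2 := inPlane_term_le r (-c) hr0 hr (by rw [abs_neg]; exact hc)
  have hc1 : c ≤ 1 := (le_abs_self c).trans hc
  have hc2 : -1 ≤ c := by linarith [neg_abs_le c]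
  have hcsq : c ^ 2 ≤ 1 := by nlinarith
  have hsum : ((-c) ^ 2 + 2 * r + r ^ 2) * (1 + 8 * r) + (c ^ 2 + 2 * r + r ^ 2) * (1 + 8 * r) ≤
      2 * c ^ 2 + 26 * r := by
    have h1 : (-c) ^ 2 = c ^ 2 := by ring
    rw [h1]
    have hr2 : r ^ 2 ≤ r / 8 := by nlinarith
    have hr3 : r ^ 3 ≤ r / 64 := by nlinarith
    nlinarith [mul_nonneg (sq_nonneg c) hr0.le]
  linarith [t1, t2, hsum]

set_option maxHeartbeats 400000 in
/-- **Upper bounds of the two slaving weights of a principal coset.** For `ℓ, K ≠ 0` with `8|ℓ| ≤ |K|`, a real unit normal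
`ζ` of `span(ℓ, K)` and the in-plane frame `p_J = |k_J|⁻¹k_J × ζ`, `k_J = ℓ + JK`:
`σ_o = 1/(d₋₁−d₀) + 1/(d₁−d₀) ≤ 2 + 2|ℓ|/|K|` and
`σ_i = s₋₁²/(d₋₁−d₀) + s₀²/(d₁−d₀) ≤ 2(ℓ·K)²/(|ℓ|²|K|²) + 26|ℓ|/|K|` (`d_J = |k_J|²/|K|²`, `s_J = p_J·p_{J+1}`). -/
theorem slaving_weights_upper (ℓ K : Fin 3 → ℤ) (hℓ : ℓ ≠ 0) (hK : K ≠ 0)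
    (h8 : 8 * ‖latticeVec ℓ‖ ≤ ‖latticeVec K‖) {ζr : Fin 3 → ℝ} (hζ1 : ζr ⬝ᵥ ζr = 1)
    (hζ0 : ζr ⬝ᵥ (fun i => ((ℓ i : ℤ) : ℝ)) = 0) (hζK : ζr ⬝ᵥ (fun i => ((K i : ℤ) : ℝ)) = 0)
    {p : ℤ → Fin 3 → ℝ}
    (hp : ∀ J : ℤ, p J = (Real.sqrt ((fun i => (((ℓ + J • K) i : ℤ) : ℝ)) ⬝ᵥ (fun i => (((ℓ + J • K) i : ℤ) : ℝ))))⁻¹ •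
        (fun i => (((ℓ + J • K) i : ℤ) : ℝ)) ⨯₃ ζr) :
    1 / (freqNormSq (ℓ + (-1 : ℤ) • K) / freqNormSq K - freqNormSq ℓ / freqNormSq K) +
        1 / (freqNormSq (ℓ + (1 : ℤ) • K) / freqNormSq K - freqNormSq ℓ / freqNormSq K) ≤
      2 + 2 * (‖latticeVec ℓ‖ / ‖latticeVec K‖) ∧
    (p (-1) ⬝ᵥ p 0) ^ 2 / (freqNormSq (ℓ + (-1 : ℤ) • K) / freqNormSq K - freqNormSq ℓ / freqNormSq K) +
        (p 0 ⬝ᵥ p 1) ^ 2 / (freqNormSq (ℓ + (1 : ℤ) • K) / freqNormSq K - freqNormSq ℓ / freqNormSq K) ≤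
      2 * (((fun i => ((ℓ i : ℤ) : ℝ)) ⬝ᵥ (fun i => ((K i : ℤ) : ℝ))) ^ 2 / (freqNormSq ℓ * freqNormSq K)) +
        26 * (‖latticeVec ℓ‖ / ‖latticeVec K‖) := by
  set lr : Fin 3 → ℝ := fun i => ((ℓ i : ℤ) : ℝ) with hlr
  set Kr : Fin 3 → ℝ := fun i => ((K i : ℤ) : ℝ) with hKr
  set A : ℝ := ‖latticeVec ℓ‖ with hA
  set B : ℝ := ‖latticeVec K‖ with hB
  set C : ℝ := lr ⬝ᵥ Kr with hC
  have hA0 : 0 < A := lt_of_lt_of_le one_pos (one_le_norm_latticeVec hℓ)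
  have hB0 : 0 < B := lt_of_lt_of_le one_pos (one_le_norm_latticeVec hK)
  have ha : lr ⬝ᵥ lr = A ^ 2 := by rw [← freqNormSq_eq_dotProduct, ← norm_latticeVec_sq]
  have hb : Kr ⬝ᵥ Kr = B ^ 2 := by rw [← freqNormSq_eq_dotProduct, ← norm_latticeVec_sq]
  have hℓf : freqNormSq ℓ = A ^ 2 := by rw [← norm_latticeVec_sq]
  have hKf : freqNormSq K = B ^ 2 := by rw [← norm_latticeVec_sq]
  -- Cauchy–Schwarz: `|C| ≤ AB`
  have hCS : |C| ≤ A * B := by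
    have h := abs_real_inner_le_norm (latticeVec ℓ) (latticeVec K)
    have e : ⟪latticeVec ℓ, latticeVec K⟫ = C := by
      rw [EuclideanSpace.inner_eq_star_dotProduct, star_trivial, dotProduct_comm, hC]
      simp [hlr, hKr, dotProduct, latticeVec_apply]
    rw [e] at h
    exact h
  -- the coset norms
  have hJf : ∀ J : ℤ, freqNormSq (ℓ + J • K) = A ^ 2 + 2 * (J : ℝ) * C + (J : ℝ) ^ 2 * B ^ 2 := by
    intro J
    rw [freqNormSq_eq_dotProduct]
    have e : (fun i => (((ℓ + J • K) i : ℤ) : ℝ)) = lr + (J : ℝ) • Kr := by funext i; simp [hlr, hKr]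
    rw [e, add_dotProduct, dotProduct_add, dotProduct_add, smul_dotProduct, dotProduct_smul, dotProduct_smul,
      smul_dotProduct, dotProduct_comm Kr lr, ha, hb, ← hC]
    simp only [smul_eq_mul]
    ring
  -- the reduced variables
  set r : ℝ := A / B with hr
  set c : ℝ := C / (A * B) with hc
  have hr0 : 0 < r := div_pos hA0 hB0
  have hr8 : r ≤ 1 / 8 := by rw [hr, div_le_iff₀ hB0]; linarith
  have hcabs : |c| ≤ 1 := by
    rw [hc, abs_div, abs_of_pos (mul_pos hA0 hB0), div_le_one (mul_pos hA0 hB0)]; exact hCS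
  have hCe : C = c * (A * B) := by rw [hc]; field_simp
  have hAe : A = r * B := by rw [hr]; field_simp
  have hc1 : c ≤ 1 := (le_abs_self c).trans hcabs
  have hc2 : -1 ≤ c := by linarith [neg_abs_le c]
  -- gaps in reduced form
  have hgp : freqNormSq (ℓ + (1 : ℤ) • K) / freqNormSq K - freqNormSq ℓ / freqNormSq K = 1 + 2 * r * c := by
    rw [hJf, hℓf, hKf, hCe, hAe]; field_simp; push_cast; ring
  have hgm : freqNormSq (ℓ + (-1 : ℤ) • K) / freqNormSq K - freqNormSq ℓ / freqNormSq K = 1 - 2 * r * c := by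
    rw [hJf, hℓf, hKf, hCe, hAe]; field_simp; push_cast; ring
  have hlo : -r ≤ r * c := by nlinarith
  have hhi : r * c ≤ r := by nlinarith
  refine ⟨?_, ?_⟩
  · -- out of plane: `2/(1 − 4r²c²) ≤ 2 + 2r`
    rw [hgp, hgm]
    exact outPlane_reduced_le r c hr0 hr8 hcabs
  · -- in plane
    -- the two squared links in reduced form
    have hnorm2 : ∀ J : ℤ, (fun i => (((ℓ + J • K) i : ℤ) : ℝ)) ⬝ᵥ (fun i => (((ℓ + J • K) i : ℤ) : ℝ)) =
        freqNormSq (ℓ + J • K) := fun J => (freqNormSq_eq_dotProduct _).symm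
    have hζJ : ∀ J : ℤ, ζr ⬝ᵥ (fun i => (((ℓ + J • K) i : ℤ) : ℝ)) = 0 := fun J => zeta_dot_coset hζ0 hζK J
    have hlink : ∀ J J' : ℤ, p J ⬝ᵥ p J' = (Real.sqrt (freqNormSq (ℓ + J • K)))⁻¹ *
        (Real.sqrt (freqNormSq (ℓ + J' • K)))⁻¹ *
        ((fun i => (((ℓ + J • K) i : ℤ) : ℝ)) ⬝ᵥ (fun i => (((ℓ + J' • K) i : ℤ) : ℝ))) := by
      intro J J'
      rw [hp J, hp J', inPlane_link_eq_cos (ℓ + J • K) (ℓ + J' • K) hζ1 (hζJ J) (hζJ J'), hnorm2, hnorm2]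
    have hdotJJ : ∀ J J' : ℤ, (fun i => (((ℓ + J • K) i : ℤ) : ℝ)) ⬝ᵥ (fun i => (((ℓ + J' • K) i : ℤ) : ℝ)) =
        A ^ 2 + ((J : ℝ) + (J' : ℝ)) * C + (J : ℝ) * (J' : ℝ) * B ^ 2 := by
      intro J J'
      have e1 : (fun i => (((ℓ + J • K) i : ℤ) : ℝ)) = lr + (J : ℝ) • Kr := by funext i; simp [hlr, hKr]
      have e2 : (fun i => (((ℓ + J' • K) i : ℤ) : ℝ)) = lr + (J' : ℝ) • Kr := by funext i; simp [hlr, hKr]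
      rw [e1, e2, add_dotProduct, dotProduct_add, dotProduct_add, smul_dotProduct, dotProduct_smul, dotProduct_smul,
        smul_dotProduct, dotProduct_comm Kr lr, ha, hb, ← hC]
      simp only [smul_eq_mul]
      ring
    have hf0 : freqNormSq (ℓ + (0 : ℤ) • K) = A ^ 2 := by rw [hJf]; push_cast; ring
    have hf1 : freqNormSq (ℓ + (1 : ℤ) • K) = B ^ 2 * (r ^ 2 + 2 * r * c + 1) := by
      rw [hJf, hCe, hAe]; push_cast; ring
    have hfm1 : freqNormSq (ℓ + (-1 : ℤ) • K) = B ^ 2 * (r ^ 2 + 2 * r * (-c) + 1) := by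
      rw [hJf, hCe, hAe]; push_cast; ring
    have hD1 : 0 < r ^ 2 + 2 * r * c + 1 := by nlinarith [sq_nonneg r, hlo]
    have hDm1 : 0 < r ^ 2 + 2 * r * (-c) + 1 := by nlinarith [sq_nonneg r, hhi]
    have hsq : ∀ {x : ℝ}, 0 < x → (Real.sqrt x)⁻¹ ^ 2 = x⁻¹ := fun hx => by
      rw [inv_pow, Real.sq_sqrt hx.le]
    have hs0 : (p 0 ⬝ᵥ p 1) ^ 2 = (c + r) ^ 2 / (r ^ 2 + 2 * r * c + 1) := by
      rw [hlink 0 1, hdotJJ, hf0, hf1, mul_pow, mul_pow, hsq (by positivity), hsq (by positivity), hCe, hAe]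
      field_simp
      push_cast
      ring
    have hsm1 : (p (-1) ⬝ᵥ p 0) ^ 2 = (-c + r) ^ 2 / (r ^ 2 + 2 * r * (-c) + 1) := by
      rw [hlink (-1) 0, hdotJJ, hf0, hfm1, mul_pow, mul_pow, hsq (by positivity), hsq (by positivity), hCe, hAe]
      field_simp
      push_cast
      ring
    have hcos : ((fun i => ((ℓ i : ℤ) : ℝ)) ⬝ᵥ (fun i => ((K i : ℤ) : ℝ))) ^ 2 / (freqNormSq ℓ * freqNormSq K) = c ^ 2 := by
      rw [← hC, hℓf, hKf, hCe]; field_simp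
    rw [hs0, hsm1, hgp, hgm, hcos]
    have e1 : (c + r) ^ 2 / (r ^ 2 + 2 * r * c + 1) / (1 + 2 * r * c) =
        (c + r) ^ 2 / ((r ^ 2 + 2 * r * c + 1) * (1 + 2 * r * c)) := by rw [div_div]
    have e2 : (-c + r) ^ 2 / (r ^ 2 + 2 * r * (-c) + 1) / (1 - 2 * r * c) =
        (-c + r) ^ 2 / ((r ^ 2 + 2 * r * (-c) + 1) * (1 + 2 * r * (-c))) := by rw [div_div]; ring_nf
    rw [e1, e2]
    exact inPlane_reduced_le r c hr0 hr8 hcabs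

end Summit.AnomalousDissipation.AnomalousDissipation.Theorems.SolenoidalFractalHomogenisation.RealisedQuasiStaticCellLaw

end
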